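import Summits.KontsevichZagierPeriods.KontsevichZagierPeriods.Theorems.RootDecompRationalCubeDichotomyRankDescentP22

/-! # `RootDecompRationalCubeDichotomyRankDescentP23` — part 9/9 of the mechanical ≤400-line split of `RankDescent_delta_v12_to_v14h_P15plus.lean` (sha256 311877f354eea7b0…)
Source: decomp-kz lens-2 g15 RankDescent_delta_v12_to_v14h_P15plus.lean @311877f3 (critic CLEARED g7-6 l.1400: 26322 ⟺ LetterDegenerateKernel, GenericKernel THEOREM); --supports stmt-KontsevichZagierPeriods-26322.
Split by census-1 g10 `gen/splitlean.py`: scopes re-opened with their `open`/`variable`/`set_option` context; mathematics and declaration order unchanged. -/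

noncomputable section
open MeasureTheory Set MvPolynomial
open Literature.NumberTheory.Transcendental
open Literature.NumberTheory.Transcendental.KZ
namespace Summit.KontsevichZagierPeriods.RootDecompRationalCubeDichotomy.Rung26322.RankDescent
variable {M : ℕ}
open MeasureTheory Set MvPolynomial in
open Literature.NumberTheory.Transcendental in
open Literature.NumberTheory.Transcendental.KZ in
open MeasureTheory Set MvPolynomial in
open Literature.NumberTheory.Transcendental in
open Literature.NumberTheory.Transcendental.KZ in
/-- Soundness: congruent formal combinations have equal values. (cite KontsevichZagier2001, §1.2) -/
private theorem eval_eq_of_sub_mem {x y : FormalRep} (h : x - y ∈ relations) : eval x = eval y := by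
  have h' := relations_le_ker_eval_holds h
  rw [AddMonoidHom.mem_ker, map_sub] at h'
  exact sub_eq_zero.1 h'

section LetterCriterion
variable {k : ℕ}
section LandenClass
variable (q : ℚ) (hq1 : 1 < q)

/-- **26322 on the whole Landen class** (`N = 0`), modulo the two-point input at level 1: every cube
representation `[P/Q_L]` with value `0` is a relation — the first NON-GENERIC class decided, by THEOREM U's
step plus ONE substitution move. (cite KontsevichZagier2001, §1.2; arXiv:2010.09167, Corollary 1) -/
theorem landen_class_single (hN : TwoPointNew q (-q) (landen_h₁ q hq1) (landen_h₂ q hq1) 1)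
    (q' : IntegralRep 2) (P : MvPolynomial (Fin 2) ℚ)
    (hd : q'.domain = Set.pi Set.univ (fun _ : Fin 2 => Set.Icc (0:ℝ) 1))
    (hf : ∀ z ∈ Set.pi Set.univ (fun _ : Fin 2 => Set.Icc (0:ℝ) 1),
      q'.integrand z = MvPolynomial.aeval z P / MvPolynomial.aeval z (landenQ q))
    (h0 : q'.value = 0) :
    ∃ N : ℕ, (fun y : FormalRep => of piRep * y)^[N] (of q') ∈ relations := by
  refine ⟨0, ?_⟩
  have hQ : ∀ z ∈ Set.pi Set.univ (fun _ : Fin 2 => Set.Icc (0:ℝ) 1), MvPolynomial.aeval z (landenQ q) ≠ 0 :=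
    fun z hz => landenQ_ne_zero q hq1 z (by rw [KZ.cube_eq_pi]; exact hz)
  have h1 := of_sub_cubeRFun_mem q' P (landenQ q) hd hQ hf
  have hTT : cubeRFun P (landenQ q) hQ = landenT q hq1 2 P := rfl
  have hval : (landenT q hq1 2 P).rep.value = 0 := by
    rw [← hTT, ← eval_of, ← eval_eq_of_sub_mem h1, eval_of, h0]
  have h2 := landen_class_decided q hq1 hN P hval
  have e : of q' = (of q' - of (cubeRFun P (landenQ q) hQ).rep) + of (landenT q hq1 2 P).rep := by
    rw [hTT]; abel
  rw [Function.iterate_zero, id, e]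
  exact add_mem h1 h2

end LandenClass

section CanonicalSystem

/-! ### §18e — THE CANONICAL SYSTEM: genericity is a property of the face system of `Q` alone

`IsGeneric Q` quantifies over ALL zero-free face-closed systems through `Q`; but genericity RESTRICTS to
subsystems, so it is equivalent to genericity of the LEAST face-closed system through `Q` — its face system
`minSys Q` (the iterated faces `Q|_{x_{j₁} = c₁, …}`, `c ∈ {0,1}`, finitely many per level). `¬ IsGeneric Q` is
therefore a concrete statement about `Q` and its faces: a zero on a closed face, a failure of SPAN over some
face, or a `ℚ`-linear relation among the letter values of the faces modulo the lower face values. -/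

/-- **The face system of `Q`**: `minSys Q k` = the dimension-`k` polynomials lying in EVERY face-closed system
through `Q` (= `Q` itself at level `m` and its iterated faces below). (folklore) -/
def minSys {m : ℕ} (Q : MvPolynomial (Fin m) ℚ) : (k : ℕ) → Set (MvPolynomial (Fin k) ℚ) :=
  fun k => {F | ∀ D : (k : ℕ) → Set (MvPolynomial (Fin k) ℚ), FaceClosed D → Q ∈ D m → F ∈ D k}

/-- Auxiliary step `mem_minSys_self` (§18e): mem min Sys self. [bookkeeping] -/
theorem mem_minSys_self {m : ℕ} (Q : MvPolynomial (Fin m) ℚ) : Q ∈ minSys Q m :=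
  fun _ _ hQ => hQ

/-- The face system is face-closed. [folklore] -/
theorem faceClosed_minSys {m : ℕ} (Q : MvPolynomial (Fin m) ℚ) : FaceClosed (minSys Q) :=
  fun k F hF j c hc D hD hQ => hD k F (hF D hD hQ) j c hc

/-- The face system is the LEAST face-closed system through `Q`. [folklore] -/
theorem minSys_subset {m : ℕ} {Q : MvPolynomial (Fin m) ℚ} {D : (k : ℕ) → Set (MvPolynomial (Fin k) ℚ)}
    (hD : FaceClosed D) (hQ : Q ∈ D m) (k : ℕ) : minSys Q k ⊆ D k :=
  fun _ hF => hF D hD hQ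

/-- Auxiliary step `zeroFree_of_subset` (§18e): zero Free of subset. [bookkeeping] -/
theorem zeroFree_of_subset {D D' : (k : ℕ) → Set (MvPolynomial (Fin k) ℚ)} (h : ∀ k, D' k ⊆ D k)
    (hz : ZeroFree D) : ZeroFree D' :=
  fun k F hF => hz k F (h k hF)

/-- Auxiliary step `VSpan_mono_sys` (§18e): VSpan mono sys. [bookkeeping] -/
theorem VSpan_mono_sys {D D' : (k : ℕ) → Set (MvPolynomial (Fin k) ℚ)} (h : ∀ k, D' k ⊆ D k) (k : ℕ) :
    VSpan D' k ≤ VSpan D k :=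
  Submodule.span_mono fun _ ⟨j, P, F, hj, hF, hv⟩ => ⟨j, P, F, hj, h j hF, hv⟩

/-- **Genericity restricts to subsystems**: `D' ⊆ D` levelwise and `GenAt D (k+1)` ⟹ `GenAt D' (k+1)` — keep the
letters whose denominator lies in `D'` (SPAN coefficients are supported there already), and INDEP modulo the
smaller span `VSpan D' k ≤ VSpan D k` is weaker. [folklore] -/
theorem genAt_of_subset {D D' : (k : ℕ) → Set (MvPolynomial (Fin k) ℚ)} (h : ∀ k, D' k ⊆ D k) (n : ℕ)
    (hg : GenAt D n) : GenAt D' n := by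
  classical
  obtain ⟨ι, den, num, hden, hspan, hind⟩ := hg
  refine ⟨{i : ι // den i ∈ D' (n + 1)}, fun i => den i.1, fun i => num i.1, fun i => i.2, ?_, ?_⟩
  · intro F hF P
    obtain ⟨c, hc, hP⟩ := hspan F (h _ hF) P
    have hp : ∀ i ∈ c.support, den i ∈ D' (n + 1) := fun i hi => (hc i hi).symm ▸ hF
    refine ⟨c.subtypeDomain (fun i => den i ∈ D' (n + 1)), fun i hi => hc i.1 ?_, ?_⟩
    · rw [Finsupp.mem_support_iff] at hi ⊢
      simpa using hi
    · rwa [Finsupp.sum_subtypeDomain_index (h := fun i r => C r * num i) hp]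
  · intro c hc
    have hc' : (c.mapDomain Subtype.val).sum (fun i r => (r : ℝ) * cubeVal (n + 1) (num i) (den i))
        ∈ VSpan D n := by
      rw [Finsupp.sum_mapDomain_index_inj Subtype.val_injective]
      exact VSpan_mono_sys h n hc
    have h0 := hind _ hc'
    exact Finsupp.mapDomain_injective Subtype.val_injective (by rw [Finsupp.mapDomain_zero]; exact h0)

/-- **THE CANONICAL SYSTEM.** `Q` is letter-generic iff its own face system is zero-free and letter-generic at
the levels `2 … m`:  `IsGeneric Q ↔ ZeroFree (minSys Q) ∧ ∀ k, k + 2 ≤ m → GenAt (minSys Q) (k+1)`.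
So the cut of the node is a property of `Q` and its finitely many iterated faces alone. [folklore] -/
theorem isGeneric_iff_minSys {m : ℕ} (Q : MvPolynomial (Fin m) ℚ) :
    IsGeneric Q ↔ ZeroFree (minSys Q) ∧ ∀ k, k + 2 ≤ m → GenAt (minSys Q) (k + 1) := by
  constructor
  · rintro ⟨D, hz, hfc, hQ, hg⟩
    have hsub : ∀ k, minSys Q k ⊆ D k := minSys_subset hfc hQ
    exact ⟨zeroFree_of_subset hsub hz, fun k hk => genAt_of_subset hsub (k + 1) (hg k hk)⟩
  · rintro ⟨hz, hg⟩
    exact ⟨minSys Q, hz, faceClosed_minSys Q, mem_minSys_self Q, hg⟩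

/-- The special side, canonically: `¬ IsGeneric Q` iff the face system of `Q` has a zero on a closed cube or a
level `2 ≤ k+2 ≤ m` at which it is NOT letter-generic. [folklore] -/
theorem not_isGeneric_iff_minSys {m : ℕ} (Q : MvPolynomial (Fin m) ℚ) :
    ¬ IsGeneric Q ↔ (ZeroFree (minSys Q) → ∃ k, k + 2 ≤ m ∧ ¬ GenAt (minSys Q) (k + 1)) := by
  rw [isGeneric_iff_minSys]
  constructor
  · intro h hz
    by_contra hk
    exact h ⟨hz, fun k hkm => by_contra fun hng => hk ⟨k, hkm, hng⟩⟩
  · rintro h ⟨hz, hg⟩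
    obtain ⟨k, hk, hng⟩ := h hz
    exact hng (hg k hk)

/-- Genericity of a denominator is inherited from ANY generic system through it, and read off on its face
system: e.g. the towers and the two-point systems certify their members' face systems. [folklore] -/
theorem genSys_minSys_of_mem {m : ℕ} {Q : MvPolynomial (Fin m) ℚ} {D : (k : ℕ) → Set (MvPolynomial (Fin k) ℚ)}
    (hz : ZeroFree D) (hfc : FaceClosed D) (hQ : Q ∈ D m) (hg : ∀ k, k + 2 ≤ m → GenAt D (k + 1)) :
    ZeroFree (minSys Q) ∧ ∀ k, k + 2 ≤ m → GenAt (minSys Q) (k + 1) :=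
  (isGeneric_iff_minSys Q).1 ⟨D, hz, hfc, hQ, hg⟩

/-! ### §18e-bis  Zero-freeness of the face system is zero-freeness of `Q`; the criterion ON THE FACES -/

/-- The system of ALL polynomials without zero on the closed cube. (folklore) -/
def zfSys : (k : ℕ) → Set (MvPolynomial (Fin k) ℚ) := fun k => {F | ∀ x ∈ KZ.cube k, aeval x F ≠ 0}

/-- Auxiliary step `zeroFree_zfSys` (§18e-bis): zero Free zf Sys. [bookkeeping] -/
theorem zeroFree_zfSys : ZeroFree zfSys := fun _ _ hF => hF

/-- Faces of a zero-free polynomial are zero-free: `zfSys` is face-closed. [folklore] -/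
theorem faceClosed_zfSys : FaceClosed zfSys := by
  intro k F hF j c hc x hx
  rw [aeval_bind₁_insX]
  refine hF _ (insertNth_mem_cube hx j ?_)
  rcases hc with rfl | rfl
  · exact le_rfl_and
  · exact zero_le_one_and

/-- `ZeroFree (minSys Q)` is exactly «`Q` has no zero on the closed cube» (the standing hypothesis of
crux 26322). [folklore] -/
theorem zeroFree_minSys_iff {m : ℕ} (Q : MvPolynomial (Fin m) ℚ) :
    ZeroFree (minSys Q) ↔ ∀ x ∈ KZ.cube m, aeval x Q ≠ 0 :=
  ⟨fun hz => hz m Q (mem_minSys_self Q),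
   fun hQ => zeroFree_of_subset (minSys_subset faceClosed_zfSys (show Q ∈ zfSys m from hQ)) zeroFree_zfSys⟩

/-- **THE CRITERION ON THE FACES OF `Q`:** `Q` is GENERIC iff it is zero-free on the closed cube and, at
every level `2 ≤ n+1 ≤ m`, the letters of ITS FACE SYSTEM satisfy SPAN and INDEP. [new] -/
theorem isGeneric_iff_faces {m : ℕ} (Q : MvPolynomial (Fin m) ℚ) :
    IsGeneric Q ↔ (∀ x ∈ KZ.cube m, aeval x Q ≠ 0) ∧ ∀ k, k + 2 ≤ m → GenAt (minSys Q) (k + 1) := by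
  rw [isGeneric_iff_minSys, zeroFree_minSys_iff]

/-- In the setting of crux 26322 (`Q` zero-free on the closed cube) SPECIAL means exactly: at some level
the letters of THE FACES OF `Q` fail SPAN or are `ℚ`-dependent modulo the lower face values. [new] -/
theorem not_isGeneric_iff_faces {m : ℕ} (Q : MvPolynomial (Fin m) ℚ)
    (hQ : ∀ x ∈ KZ.cube m, aeval x Q ≠ 0) :
    ¬ IsGeneric Q ↔ ∃ k, k + 2 ≤ m ∧ ¬ GenAt (minSys Q) (k + 1) := by
  rw [isGeneric_iff_faces]
  constructor
  · intro h
    by_contra hc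
    exact h ⟨hQ, fun k hk => by
      by_contra hg
      exact hc ⟨k, hk, hg⟩⟩
  · rintro ⟨k, hk, hg⟩ ⟨_, h⟩
    exact hg (h k hk)

/-- The Landen resident, CANONICALLY: the face system of `Q_L = (q+xy)(−q+xy)(−q²+xy)` is not
letter-generic at level 2 (its three top letters are `ℚ`-dependent modulo the face values — Landen).
[new] -/
theorem not_genAt_minSys_landenQ (q : ℚ) (hq1 : 1 < q) : ¬ GenAt (minSys (landenQ q)) 1 := by
  obtain ⟨k, hk, hg⟩ :=
    (not_isGeneric_iff_faces (landenQ q) (landenQ_ne_zero q hq1)).1 (not_isGeneric_landenQ q hq1)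
  obtain rfl : k = 0 := by omega
  exact hg

/-! ### §18f  The face system EXPLICITLY: empty above `m`, `{Q}` at level `m`, each lower level = the faces
`x_j := 0, 1` of the level above — hence FINITELY MANY polynomials per level, and the letter test
`GenAt (minSys Q) (k+1)` of the criterion is a finite check-list attached to `Q`. -/

/-- No iterated face above the dimension of `Q`. [folklore] -/
theorem minSys_eq_empty {m : ℕ} (Q : MvPolynomial (Fin m) ℚ) {k : ℕ} (hk : m < k) : minSys Q k = ∅ := by
  let D : (k' : ℕ) → Set (MvPolynomial (Fin k') ℚ) := fun k' => {G | G ∈ minSys Q k' ∧ k' ≤ m}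
  have hD : FaceClosed D := fun k' F hF j c hc =>
    ⟨faceClosed_minSys Q k' F hF.1 j c hc, (Nat.le_succ k').trans hF.2⟩
  have hQ : Q ∈ D m := ⟨mem_minSys_self Q, le_rfl⟩
  ext G
  simp only [Set.mem_empty_iff_false, iff_false]
  exact fun hG => absurd (minSys_subset hD hQ k hG).2 (by omega)

/-- At the top level the face system is `{Q}`. [folklore] -/
theorem minSys_top {m : ℕ} (Q : MvPolynomial (Fin m) ℚ) : minSys Q m = {Q} := by
  let D : (k' : ℕ) → Set (MvPolynomial (Fin k') ℚ) := fun k' =>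
    {G | G ∈ minSys Q k' ∧ (m ≤ k' → k' = m ∧ rename Fin.val G = rename Fin.val Q)}
  have hD : FaceClosed D := by
    intro k' F hF j c hc
    refine ⟨faceClosed_minSys Q k' F hF.1 j c hc, fun hk => ?_⟩
    exact absurd (hF.2 (by omega)).1 (by omega)
  have hQ : Q ∈ D m := ⟨mem_minSys_self Q, fun _ => ⟨rfl, rfl⟩⟩
  ext G
  simp only [Set.mem_singleton_iff]
  constructor
  · intro hG
    exact MvPolynomial.rename_injective _ Fin.val_injective ((minSys_subset hD hQ m hG).2 le_rfl).2
  · rintro rfl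
    exact mem_minSys_self _

/-- Below the top, level `k` of the face system consists EXACTLY of the faces `x_j := 0, 1` of its level
`k+1`. [folklore] -/
theorem mem_minSys_iff_face {m : ℕ} (Q : MvPolynomial (Fin m) ℚ) {k : ℕ} (hk : k < m)
    (G : MvPolynomial (Fin k) ℚ) :
    G ∈ minSys Q k ↔ ∃ F ∈ minSys Q (k + 1), ∃ (j : Fin (k + 1)) (c : ℚ),
      (c = 0 ∨ c = 1) ∧ G = bind₁ (insX j c) F := by
  constructor
  · intro hG
    let D : (k' : ℕ) → Set (MvPolynomial (Fin k') ℚ) := fun k' =>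
      {G' | G' ∈ minSys Q k' ∧ (k' < m → ∃ F ∈ minSys Q (k' + 1), ∃ (j : Fin (k' + 1)) (c : ℚ),
        (c = 0 ∨ c = 1) ∧ G' = bind₁ (insX j c) F)}
    have hD : FaceClosed D := fun k' F hF j c hc =>
      ⟨faceClosed_minSys Q k' F hF.1 j c hc, fun _ => ⟨F, hF.1, j, c, hc, rfl⟩⟩
    have hQ : Q ∈ D m := ⟨mem_minSys_self Q, fun h => absurd h (lt_irrefl m)⟩
    exact (minSys_subset hD hQ k hG).2 hk
  · rintro ⟨F, hF, j, c, hc, rfl⟩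
    exact faceClosed_minSys Q k F hF j c hc

/-- **The face system is FINITE at every level** (at most `2(k+1)·2(k+2)⋯2m` polynomials at level
`k < m`). [folklore] -/
theorem minSys_finite {m : ℕ} (Q : MvPolynomial (Fin m) ℚ) (k : ℕ) : (minSys Q k).Finite := by
  suffices h : ∀ d k, m ≤ k + d → (minSys Q k).Finite from h m k (Nat.le_add_left m k)
  intro d
  induction d with
  | zero =>
    intro k hk
    rcases (show m ≤ k by simpa using hk).eq_or_lt with h | h
    · subst h
      rw [minSys_top]
      exact Set.finite_singleton Q
    · rw [minSys_eq_empty Q h]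
      exact Set.finite_empty
  | succ d ih =>
    intro k hk
    by_cases h : m ≤ k + d
    · exact ih k h
    · have hkm : k < m := by omega
      refine ((ih (k + 1) (by omega)).biUnion fun F _ =>
        Set.finite_range (fun p : Fin (k + 1) × Bool =>
          bind₁ (insX p.1 (if p.2 then (1 : ℚ) else 0)) F)).subset ?_
      intro G hG
      obtain ⟨F, hF, j, c, hc, rfl⟩ := (mem_minSys_iff_face Q hkm G).1 hG
      refine Set.mem_biUnion hF ?_
      rcases hc with rfl | rfl
      · exact ⟨(j, false), by simp⟩
      · exact ⟨(j, true), by simp⟩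

/-! ### §18g  Dimension two spelled out: the face system of `Q(x,y)` is `{Q}`, its four edge restrictions
`Q(ε,y), Q(x,ε)` (`ε = 0,1`), and their corner constants — so `GenAt (minSys Q) 1` is the statement about the
EDGE LETTERS `∫₀¹ P/Q(ε,y)`, `∫₀¹ P/Q(x,ε)` modulo `ℚ`·(corner values). -/

/-- Auxiliary step `mem_minSys_two_one` (§18g): mem min Sys two one. [bookkeeping] -/
theorem mem_minSys_two_one (Q : MvPolynomial (Fin 2) ℚ) (G : MvPolynomial (Fin 1) ℚ) :
    G ∈ minSys Q 1 ↔ ∃ (j : Fin 2) (c : ℚ), (c = 0 ∨ c = 1) ∧ G = bind₁ (insX j c) Q := by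
  rw [mem_minSys_iff_face Q (by norm_num) G]
  constructor
  · rintro ⟨F, hF, j, c, hc, rfl⟩
    rw [minSys_top, Set.mem_singleton_iff] at hF
    exact ⟨j, c, hc, by rw [hF]⟩
  · rintro ⟨j, c, hc, rfl⟩
    exact ⟨Q, mem_minSys_self Q, j, c, hc, rfl⟩

/-- Auxiliary step `mem_minSys_two_zero` (§18g): mem min Sys two zero. [bookkeeping] -/
theorem mem_minSys_two_zero (Q : MvPolynomial (Fin 2) ℚ) (G : MvPolynomial (Fin 0) ℚ) :
    G ∈ minSys Q 0 ↔ ∃ (j : Fin 2) (c : ℚ) (j' : Fin 1) (c' : ℚ), (c = 0 ∨ c = 1) ∧ (c' = 0 ∨ c' = 1) ∧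
      G = bind₁ (insX j' c') (bind₁ (insX j c) Q) := by
  rw [mem_minSys_iff_face Q (by norm_num) G]
  constructor
  · rintro ⟨F, hF, j', c', hc', rfl⟩
    obtain ⟨j, c, hc, rfl⟩ := (mem_minSys_two_one Q F).1 hF
    exact ⟨j, c, j', c', hc, hc', rfl⟩
  · rintro ⟨j, c, j', c', hc, hc', rfl⟩
    exact ⟨_, (mem_minSys_two_one Q _).2 ⟨j, c, hc, rfl⟩, j', c', hc', rfl⟩

/-! ### §18h  THE RESIDUAL IN CANONICAL FORM: `SpecialKernel ↔ LetterDegenerateKernel`, so the node reads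
`26322 ⟸ GenericKernel (PROVED) ∧ LetterDegenerateKernel` — 26322 restricted to the `Q` whose FINITE face system fails
the letter test at some level `2 ≤ k+2 ≤ m`. -/

/-- **LETTER-DEGENERATE PIECE `LetterDegenerateKernel`** := crux 26322 `RationalCubePiKernelSingle` restricted to the
denominators `Q` whose face system `minSys Q` is NOT letter-generic at some level `k+1`, `k + 2 ≤ m` (SPAN fails or
the face letters are `ℚ`-dependent modulo the lower face values). The canonical form of `SpecialKernel`
(`specialKernel_iff_letterDegenerate`). [new] -/
def LetterDegenerateKernel : Prop :=
  ∀ (m : ℕ) (q : IntegralRep m) (P Q : MvPolynomial (Fin m) ℚ),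
    (∃ k, k + 2 ≤ m ∧ ¬ GenAt (minSys Q) (k + 1)) →
    q.domain = Set.pi Set.univ (fun _ : Fin m => Set.Icc (0:ℝ) 1) →
    (∀ z ∈ Set.pi Set.univ (fun _ : Fin m => Set.Icc (0:ℝ) 1), MvPolynomial.aeval z Q ≠ 0) →
    (∀ z ∈ Set.pi Set.univ (fun _ : Fin m => Set.Icc (0:ℝ) 1),
      q.integrand z = MvPolynomial.aeval z P / MvPolynomial.aeval z Q) →
    q.value = 0 → ∃ N : ℕ, (fun y : FormalRep => of piRep * y)^[N] (of q) ∈ relations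

/-- Auxiliary step `cube_zeroFree_of_pi` (§18h): cube zero Free of pi. [bookkeeping] -/
theorem cube_zeroFree_of_pi {m : ℕ} {Q : MvPolynomial (Fin m) ℚ}
    (hQ : ∀ z ∈ Set.pi Set.univ (fun _ : Fin m => Set.Icc (0:ℝ) 1), MvPolynomial.aeval z Q ≠ 0) :
    ∀ x ∈ KZ.cube m, aeval x Q ≠ 0 :=
  fun x hx => hQ x (by rw [← KZ.cube_eq_pi]; exact hx)

/-- **The special piece IS the letter-degenerate piece.** [new] -/
theorem specialKernel_iff_letterDegenerate : SpecialKernel ↔ LetterDegenerateKernel := by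
  constructor
  · intro h m q P Q hdeg hd hQ hf h0
    exact h m q P Q ((not_isGeneric_iff_faces Q (cube_zeroFree_of_pi hQ)).2 hdeg) hd hQ hf h0
  · intro h m q P Q hng hd hQ hf h0
    exact h m q P Q ((not_isGeneric_iff_faces Q (cube_zeroFree_of_pi hQ)).1 hng) hd hQ hf h0

/-- **THE NODE IN CANONICAL FORM: crux 26322 ⟸ its letter-degenerate piece alone** (the generic piece being the
theorem `genericKernel_holds`). [new] -/
theorem rationalCubePiKernelSingle_of_letterDegenerate (h : LetterDegenerateKernel) :
    Summit.KontsevichZagierPeriods.KontsevichZagierPeriods.Theses.RootDecompRationalCubeDichotomy.RationalCubePiKernelSingle :=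
  rationalCubePiKernelSingle_of_special (specialKernel_iff_letterDegenerate.2 h)

/-- Converse edge: the letter-degenerate piece is 26322 restricted, hence WEAKER-or-equal. [folklore] -/
theorem letterDegenerate_of_single
    (h : Summit.KontsevichZagierPeriods.KontsevichZagierPeriods.Theses.RootDecompRationalCubeDichotomy.RationalCubePiKernelSingle) :
    LetterDegenerateKernel :=
  specialKernel_iff_letterDegenerate.1 (special_of_single h)

end CanonicalSystem

end LetterCriterion

end Summit.KontsevichZagierPeriods.RootDecompRationalCubeDichotomy.Rung26322.RankDescent
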